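import Mathlib
import Literature.Analysis.FluidPDE.LerayHopfAssociatedPressure
import Literature.Analysis.FluidPDE.PressureDeterminedUpToTime
import Literature.Analysis.FluidPDE.ClassicalSuitable
import Literature.Analysis.FluidPDE.SuitableWeakPressure
import HarnessLib

/-!
# Route RootDecompLitSlice — cell Uᶜ `CritTameScarIsCritical` (stmt-NavierStokesRegularity-31733):
# the classical pressure of the frame IS the associated `L^{3/2}` pressure up to a gauge

Helpers toward the Tao-vacuous cell Uᶜ (`--supports 31733`; no item, no node, no registered stub).
The assembled scar law `LocalEnergyBudget.scar_le_of_pressureBudget` (landed) carries ONE remaining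
hypothesis number, the pressure flux `mpu ≥ ∬|p − c(t)||u|` for some gauge `c`. Its discharge
needs the identification of the CLASSICAL pressure `p` of the frame (`IsClassicalNSSolutionOn
(Ico 0 T) ν 0 u p` + Leray–Hopf on `[0,T]`) with the ASSOCIATED pressure of the Leray–Hopf
solution (tree: `IsLerayHopfOn.exists_associated_pressure` — `p̃ ∈ L^{3/2}((0,T) × ℝ³)`,
distributional on the slab, Stein's slice bound `‖p̃(t)‖_{3/2} ≤ C_{3/2}‖u(t)‖₃²`), up to a
function of time. Route-free (no `Theses` import):

* `PressureGauge.exists_gauge_of_distributional_of_classical` — two pressures of one velocity,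
  one distributional on the slab `(T₁,T₂) × ℝ³` and one classical on an open `S ⊇ (T₁,T₂)`, with
  the SAME viscosity `ν`, differ by a measurable function of time a.e. (the tree's
  `SmoothRepresentative.exists_gauge_of_distributional_of_classical`, there for `ν = 1`, verbatim
  for general `ν`; core: `exists_measurable_gauge_of_forall_integral_mul_divergence_eq_zero`);
* `PressureGauge.ae_restrict_slab_of_ae_ae` — iterated a.e. ⟹ product a.e. on the slab for an
  a.e.-strongly-measurable relation (measurable modification + `Measure.ae_prod_mem_iff_ae_ae_mem`);
* ★ `PressureGauge.exists_gauge_associated_pressure` — on the Uᶜ frame there are `p̃` and a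
  measurable gauge `c` with `p − c(t) = p̃` a.e. on `(0,T) × ℝ³` (product AND iterated form),
  `p̃ ∈ L^{3/2}` of the slab, and for a.e. `t`: `p̃(t) ∈ L^{3/2}`,
  `‖p̃(t)‖_{3/2} ≤ C_{3/2}‖u(t)‖₃²`.

HONEST FRAMING: helper lemmas INSIDE the Tao-vacuous cell Uᶜ; zero load of the route moves
(ROOT ⟺ U ∧ P1, critic rows 354/371/563/639/665/678); no item is re-typed. Rung 0: nothing here
proves NS regularity. Decomp-ns route-writer g40.
[cite: RusinSverak2011, §2 p. 4] [cite: EscauriazaSereginSverak2003, §3 (3.2)–(3.4)]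
-/

set_option linter.dupNamespace false

noncomputable section

namespace Summit.NavierStokesRegularity.NavierStokesRegularity.Theorems

open MeasureTheory TopologicalSpace Set Function Filter Metric
open _root_.Topology
open scoped InnerProductSpace RealInnerProductSpace ENNReal NNReal ContDiff Laplacian
open Literature.Analysis.FluidPDE

namespace PressureGauge

/-- **Two pressures of one velocity differ by a function of time (general viscosity).** Let
`(v, p)` solve Navier–Stokes with viscosity `ν` (`f = 0`) in the sense of distributions on the
slab `(T₁, T₂) × ℝ³` and let `(v, q)` be a classical solution (same `ν`) on an open time set
`S ⊇ (T₁, T₂)`, with the SAME velocity `v`. Then there is a measurable `c` with `p − q = c(t)` a.e.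
on the slab (subtract the two momentum identities: `∫∫ (p − q) div ψ = 0` for every vector test
field; then `exists_measurable_gauge_of_forall_integral_mul_divergence_eq_zero`). The tree's
`SmoothRepresentative.exists_gauge_of_distributional_of_classical` is the case `ν = 1`; same proof.
[cite: RusinSverak2011, §2 p. 4; JiaSverak2014, §3 (3.3)] -/
theorem exists_gauge_of_distributional_of_classical {ν T₁ T₂ : ℝ}
    {v : ℝ → EuclideanSpace ℝ (Fin 3) → EuclideanSpace ℝ (Fin 3)}
    {p q : ℝ → EuclideanSpace ℝ (Fin 3) → ℝ}
    (hD₁ : IsDistributionalNSSolutionOn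
      (slab (EuclideanSpace ℝ (Fin 3)) (Ioo T₁ T₂) isOpen_Ioo) ν 0 v p)
    {S : Set ℝ} (hS : IsOpen S) (hTS : Ioo T₁ T₂ ⊆ S)
    (hcl : IsClassicalNSSolutionOn S ν 0 v q) :
    ∃ c : ℝ → ℝ, Measurable c ∧
      ∀ᵐ t ∂(volume.restrict (Ioo T₁ T₂)),
        ∀ᵐ x ∂(volume : Measure (EuclideanSpace ℝ (Fin 3))), p t x - q t x = c t := by
  set Q : Opens (ℝ × (EuclideanSpace ℝ (Fin 3))) :=
    slab (EuclideanSpace ℝ (Fin 3)) (Ioo T₁ T₂) isOpen_Ioo with hQ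
  have hQS : (Q : Set (ℝ × (EuclideanSpace ℝ (Fin 3)))) ⊆
      S ×ˢ (univ : Set (EuclideanSpace ℝ (Fin 3))) := prod_mono hTS Subset.rfl
  -- the classical pair is a distributional solution on `Q`
  have hv2 : ContDiffOn ℝ 2 (uncurry v) (S ×ˢ (univ : Set (EuclideanSpace ℝ (Fin 3)))) :=
    hcl.smooth_velocity.of_le (by norm_cast)
  have hq1 : ContDiffOn ℝ 1 (uncurry q) (S ×ˢ (univ : Set (EuclideanSpace ℝ (Fin 3)))) :=
    hcl.smooth_pressure.of_le (by norm_cast)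
  have hmom : ∀ t ∈ S, ∀ x, timeDeriv v t x + convect (v t) (v t) x =
      ν • (Δ (v t)) x - gradient (q t) x +
        (0 : ℝ → (EuclideanSpace ℝ (Fin 3)) → (EuclideanSpace ℝ (Fin 3))) t x := by
    intro t ht x
    have h := hcl.momentum t ht x
    rwa [timeDerivWithin_of_mem_interior (by rwa [hS.interior_eq]) x] at h
  have hD₂ : IsDistributionalNSSolutionOn Q ν 0 v q :=
    isDistributionalNSSolutionOn_of_contDiffOn hS hQS hv2 hq1
      (continuous_const.continuousOn) hmom hcl.divFree
  -- local integrability of `F = p - q` on the slab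
  have hqc : ContinuousOn (uncurry q) (Q : Set (ℝ × (EuclideanSpace ℝ (Fin 3)))) :=
    hq1.continuousOn.mono hQS
  have hF : LocallyIntegrableOn (uncurry fun t x => p t x - q t x)
      (Ioo T₁ T₂ ×ˢ (univ : Set (EuclideanSpace ℝ (Fin 3)))) volume :=
    hD₁.2.2.1.sub (hqc.locallyIntegrableOn (measurableSet_Ioo.prod MeasurableSet.univ))
  refine exists_measurable_gauge_of_forall_integral_mul_divergence_eq_zero hF fun ψ hψ => ?_
  -- subtract the two momentum identities
  have h₁ := hD₁.2.2.2.2 ψ hψ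
  have h₂ := hD₂.2.2.2.2 ψ hψ
  set K : Set (ℝ × (EuclideanSpace ℝ (Fin 3))) := tsupport (uncurry ψ) with hK
  have hKc : IsCompact K := hψ.hasCompactSupport
  have hKQ : K ⊆ (Q : Set (ℝ × (EuclideanSpace ℝ (Fin 3)))) := hψ.tsupport_subset
  have hψ' : IsSpaceTimeTestOn (⊤ : Opens (ℝ × (EuclideanSpace ℝ (Fin 3)))) ψ := hψ.mono le_top
  have hdivc : Continuous fun z : ℝ × (EuclideanSpace ℝ (Fin 3)) =>
      VectorCalculus.divergence (ψ z.1) z.2 := hψ'.continuous_divergence_slice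
  have hdiv0 : ∀ z ∉ K, VectorCalculus.divergence (ψ z.1) z.2 = 0 := fun z hz => by
    have h0 : fderiv ℝ (ψ z.1) z.2 = 0 :=
      IsSpaceTimeTestOn.fderiv_slice_eq_zero_of_notMem (ψ := ψ) hz
    simp [VectorCalculus.divergence, h0]
  have iP₁ : Integrable (fun z : ℝ × (EuclideanSpace ℝ (Fin 3)) =>
      p z.1 z.2 * VectorCalculus.divergence (ψ z.1) z.2) volume :=
    integrable_mul_of_locallyIntegrableOn hD₁.2.2.1 hdivc hKc hKQ hdiv0
  have iP₂ : Integrable (fun z : ℝ × (EuclideanSpace ℝ (Fin 3)) =>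
      q z.1 z.2 * VectorCalculus.divergence (ψ z.1) z.2) volume :=
    integrable_mul_of_locallyIntegrableOn hD₂.2.2.1 hdivc hKc hKQ hdiv0
  set V : ℝ × (EuclideanSpace ℝ (Fin 3)) → ℝ := fun z =>
    ⟪v z.1 z.2, timeDeriv ψ z.1 z.2⟫ + ⟪v z.1 z.2, convect (v z.1) (ψ z.1) z.2⟫ +
      ν * ⟪v z.1 z.2, Δ (ψ z.1) z.2⟫ with hV
  have hV0 : ∀ z ∉ K, V z = 0 := fun z hz => by
    simp only [hV, IsSpaceTimeTestOn.timeDeriv_eq_zero_of_notMem hz,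
      laplacian_eq_zero_of_notMem_tsupport (notMem_tsupport_slice hz), inner_zero_right,
      mul_zero, add_zero, convect, IsSpaceTimeTestOn.fderiv_slice_eq_zero_of_notMem (ψ := ψ) hz,
      zero_apply]
  have hVc : ContinuousOn V (Q : Set (ℝ × (EuclideanSpace ℝ (Fin 3)))) := by
    have hvc : ContinuousOn (fun z : ℝ × (EuclideanSpace ℝ (Fin 3)) => v z.1 z.2)
        (Q : Set (ℝ × (EuclideanSpace ℝ (Fin 3)))) := hv2.continuousOn.mono hQS
    have hDψ : Continuous fun z : ℝ × (EuclideanSpace ℝ (Fin 3)) => fderiv ℝ (ψ z.1) z.2 :=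
      hψ'.continuous_fderiv_slice
    refine ((hvc.inner hψ'.continuous_timeDeriv.continuousOn).add (hvc.inner ?_)).add
      (continuousOn_const.mul (hvc.inner hψ'.continuous_laplacian_slice.continuousOn))
    exact ((hDψ.continuousOn).clm_apply hvc)
  have iV : Integrable V volume := by
    have hVK : IntegrableOn V K volume := (hVc.mono hKQ).integrableOn_compact hKc
    exact hVK.integrable_of_forall_notMem_eq_zero hV0
  have e₁ : ∫ (z : ℝ × (EuclideanSpace ℝ (Fin 3))) in (Q : Set (ℝ × (EuclideanSpace ℝ (Fin 3)))),
      (⟪v z.1 z.2, timeDeriv ψ z.1 z.2⟫ + ⟪v z.1 z.2, convect (v z.1) (ψ z.1) z.2⟫ +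
      ν * ⟪v z.1 z.2, Δ (ψ z.1) z.2⟫ + p z.1 z.2 * VectorCalculus.divergence (ψ z.1) z.2 +
      ⟪(0 : ℝ → (EuclideanSpace ℝ (Fin 3)) → (EuclideanSpace ℝ (Fin 3))) z.1 z.2, ψ z.1 z.2⟫) =
      (∫ z, V z) + ∫ z : ℝ × (EuclideanSpace ℝ (Fin 3)),
        p z.1 z.2 * VectorCalculus.divergence (ψ z.1) z.2 := by
    rw [setIntegral_eq_integral_of_forall_compl_eq_zero (fun z hz => by
      have hzK : z ∉ K := fun h => hz (hKQ h)
      simp only [hV] at hV0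
      rw [hV0 z hzK, hdiv0 z hzK]; simp), ← integral_add iV iP₁]
    refine integral_congr_ae (Eventually.of_forall fun z => ?_)
    simp only [hV, Pi.zero_apply, inner_zero_left, add_zero]
  have e₂ : ∫ (z : ℝ × (EuclideanSpace ℝ (Fin 3))) in (Q : Set (ℝ × (EuclideanSpace ℝ (Fin 3)))),
      (⟪v z.1 z.2, timeDeriv ψ z.1 z.2⟫ + ⟪v z.1 z.2, convect (v z.1) (ψ z.1) z.2⟫ +
      ν * ⟪v z.1 z.2, Δ (ψ z.1) z.2⟫ + q z.1 z.2 * VectorCalculus.divergence (ψ z.1) z.2 +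
      ⟪(0 : ℝ → (EuclideanSpace ℝ (Fin 3)) → (EuclideanSpace ℝ (Fin 3))) z.1 z.2, ψ z.1 z.2⟫) =
      (∫ z, V z) + ∫ z : ℝ × (EuclideanSpace ℝ (Fin 3)),
        q z.1 z.2 * VectorCalculus.divergence (ψ z.1) z.2 := by
    rw [setIntegral_eq_integral_of_forall_compl_eq_zero (fun z hz => by
      have hzK : z ∉ K := fun h => hz (hKQ h)
      simp only [hV] at hV0
      rw [hV0 z hzK, hdiv0 z hzK]; simp), ← integral_add iV iP₂]
    refine integral_congr_ae (Eventually.of_forall fun z => ?_)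
    simp only [hV, Pi.zero_apply, inner_zero_left, add_zero]
  rw [e₁] at h₁
  rw [e₂] at h₂
  rw [setIntegral_eq_integral_of_forall_compl_eq_zero (fun z hz => by
    have hzK : z ∉ K := fun h => hz (hKQ h)
    rw [show VectorCalculus.divergence (ψ z.1) z.2 = 0 from hdiv0 z hzK, mul_zero])]
  have e3 : ∫ z : ℝ × (EuclideanSpace ℝ (Fin 3)),
      (p z.1 z.2 - q z.1 z.2) * VectorCalculus.divergence (ψ z.1) z.2 =
      ∫ z : ℝ × (EuclideanSpace ℝ (Fin 3)), (p z.1 z.2 * VectorCalculus.divergence (ψ z.1) z.2 -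
        q z.1 z.2 * VectorCalculus.divergence (ψ z.1) z.2) := by
    refine integral_congr_ae (Eventually.of_forall fun z => ?_)
    ring
  show ∫ z : ℝ × (EuclideanSpace ℝ (Fin 3)),
      (p z.1 z.2 - q z.1 z.2) * VectorCalculus.divergence (ψ z.1) z.2 = 0
  rw [e3, integral_sub iP₁ iP₂]
  linarith

/-- **Iterated a.e. ⟹ product a.e. on a slab** for an a.e.-strongly-measurable real function:
if `D` is a.e.-strongly measurable for Lebesgue measure restricted to `(T₁,T₂) × ℝ³` and
`D(t, ·) = 0` a.e. for a.e. `t ∈ (T₁,T₂)`, then `D = 0` a.e. on the slab (pass to a strongly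
measurable modification, whose zero set is measurable, and use
`Measure.ae_prod_mem_iff_ae_ae_mem`). [folklore] -/
theorem ae_restrict_slab_of_ae_ae {T₁ T₂ : ℝ} {D : ℝ × EuclideanSpace ℝ (Fin 3) → ℝ}
    (hD : AEStronglyMeasurable D
      (volume.restrict (Ioo T₁ T₂ ×ˢ (univ : Set (EuclideanSpace ℝ (Fin 3))))))
    (h : ∀ᵐ t ∂(volume.restrict (Ioo T₁ T₂)),
      ∀ᵐ x ∂(volume : Measure (EuclideanSpace ℝ (Fin 3))), D (t, x) = 0) :
    ∀ᵐ z ∂(volume.restrict (Ioo T₁ T₂ ×ˢ (univ : Set (EuclideanSpace ℝ (Fin 3))))), D z = 0 := by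
  have hμ : (volume : Measure (ℝ × EuclideanSpace ℝ (Fin 3))).restrict
      (Ioo T₁ T₂ ×ˢ (univ : Set (EuclideanSpace ℝ (Fin 3)))) =
      (volume.restrict (Ioo T₁ T₂)).prod (volume : Measure (EuclideanSpace ℝ (Fin 3))) := by
    rw [Measure.volume_eq_prod, Measure.restrict_prod_eq_prod_univ]
  rw [hμ] at hD ⊢
  have hDD' : D =ᵐ[(volume.restrict (Ioo T₁ T₂)).prod (volume : Measure (EuclideanSpace ℝ (Fin 3)))]
      hD.mk D := hD.ae_eq_mk
  have h1 : ∀ᵐ t ∂(volume.restrict (Ioo T₁ T₂)),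
      ∀ᵐ x ∂(volume : Measure (EuclideanSpace ℝ (Fin 3))), D (t, x) = hD.mk D (t, x) :=
    Measure.ae_ae_of_ae_prod hDD'
  have hS : MeasurableSet {z : ℝ × EuclideanSpace ℝ (Fin 3) | hD.mk D z = 0} :=
    hD.stronglyMeasurable_mk.measurable (measurableSet_singleton 0)
  have h2 : ∀ᵐ t ∂(volume.restrict (Ioo T₁ T₂)),
      ∀ᵐ x ∂(volume : Measure (EuclideanSpace ℝ (Fin 3))),
        (t, x) ∈ {z : ℝ × EuclideanSpace ℝ (Fin 3) | hD.mk D z = 0} := by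
    filter_upwards [h, h1] with t ht ht1
    filter_upwards [ht, ht1] with x hx hx1
    show hD.mk D (t, x) = 0
    rw [← hx1]; exact hx
  have h3 : ∀ᵐ z ∂((volume.restrict (Ioo T₁ T₂)).prod (volume : Measure (EuclideanSpace ℝ (Fin 3)))),
      z ∈ {z : ℝ × EuclideanSpace ℝ (Fin 3) | hD.mk D z = 0} :=
    (Measure.ae_prod_mem_iff_ae_ae_mem hS).2 h2
  filter_upwards [h3, hDD'] with z hz hzz
  rw [hzz]; exact hz

/-- ★ **The classical pressure of the frame is the associated `L^{3/2}` pressure up to a gauge.**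
Frame: `T > 0`, `(u, p)` classical with viscosity `ν` on `[0,T) × ℝ³`, `u` Leray–Hopf on `[0,T]`
from `u 0`. Then there are a pressure `p̃ ∈ L^{3/2}((0,T) × ℝ³)` and a measurable gauge
`c : ℝ → ℝ` with `p(t,x) − c(t) = p̃(t,x)` for a.e. `(t,x)` in the slab (and for a.e. `x`, for a.e.
`t`), and for a.e. `t ∈ (0,T)`: `p̃(t) ∈ L^{3/2}(ℝ³)` with Stein's bound
`‖p̃(t)‖_{3/2} ≤ C_{3/2}‖u(t)‖₃²` (`p̃` = the associated pressure of the tree's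
`IsLerayHopfOn.exists_associated_pressure`; gauge by `exists_gauge_of_distributional_of_classical`).
[cite: EscauriazaSereginSverak2003, §3, proof of Thm. 1.3, (3.2)–(3.4)] -/
theorem exists_gauge_associated_pressure {ν T : ℝ} (hT : 0 < T)
    {u : ℝ → EuclideanSpace ℝ (Fin 3) → EuclideanSpace ℝ (Fin 3)}
    {p : ℝ → EuclideanSpace ℝ (Fin 3) → ℝ}
    (hcl : IsClassicalNSSolutionOn (Set.Ico 0 T) ν 0 u p) (hLH : IsLerayHopfOn T ν 0 (u 0) u) :
    ∃ (q : ℝ → EuclideanSpace ℝ (Fin 3) → ℝ) (c : ℝ → ℝ), Measurable c ∧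
      MemLp (uncurry q) (3 / 2 : ℝ≥0∞)
        (volume.restrict (Ioo 0 T ×ˢ (univ : Set (EuclideanSpace ℝ (Fin 3))))) ∧
      (∀ᵐ z ∂(volume.restrict (Ioo 0 T ×ˢ (univ : Set (EuclideanSpace ℝ (Fin 3))))),
        p z.1 z.2 - c z.1 = q z.1 z.2) ∧
      ∀ᵐ t ∂(volume.restrict (Ioo 0 T)),
        (∀ᵐ x ∂(volume : Measure (EuclideanSpace ℝ (Fin 3))), p t x - c t = q t x) ∧
        MemLp (q t) (3 / 2 : ℝ≥0∞) volume ∧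
        eLpNorm (q t) (3 / 2 : ℝ≥0∞) volume ≤ steinConstThreeHalves * eLpNorm (u t) 3 volume ^ 2 := by
  obtain ⟨q, hq32, hqD, hsl⟩ := hLH.exists_associated_pressure hT
  have hcl' : IsClassicalNSSolutionOn (Ioo 0 T) ν 0 u p :=
    hcl.mono Ioo_subset_Ico_self (uniqueDiffOn_Ioo 0 T)
  obtain ⟨c, hcm, hc⟩ :=
    exists_gauge_of_distributional_of_classical hqD isOpen_Ioo Subset.rfl hcl'
  -- `q - p = c`, i.e. `p - (-c) = q`
  refine ⟨q, fun t => -c t, hcm.neg, hq32, ?_, ?_⟩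
  · -- product form
    have hpc : ContinuousOn (uncurry p)
        (Ioo 0 T ×ˢ (univ : Set (EuclideanSpace ℝ (Fin 3)))) :=
      hcl'.smooth_pressure.continuousOn
    have hpm : AEStronglyMeasurable (uncurry p)
        (volume.restrict (Ioo 0 T ×ˢ (univ : Set (EuclideanSpace ℝ (Fin 3))))) :=
      hpc.aestronglyMeasurable (measurableSet_Ioo.prod MeasurableSet.univ)
    have hcm' : AEStronglyMeasurable (fun z : ℝ × EuclideanSpace ℝ (Fin 3) => c z.1)
        (volume.restrict (Ioo 0 T ×ˢ (univ : Set (EuclideanSpace ℝ (Fin 3))))) :=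
      (hcm.comp measurable_fst).aestronglyMeasurable
    have hDm : AEStronglyMeasurable
        (fun z : ℝ × EuclideanSpace ℝ (Fin 3) => q z.1 z.2 - p z.1 z.2 - c z.1)
        (volume.restrict (Ioo 0 T ×ˢ (univ : Set (EuclideanSpace ℝ (Fin 3))))) :=
      (hq32.1.sub hpm).sub hcm'
    have hD0 := ae_restrict_slab_of_ae_ae hDm (by
      filter_upwards [hc] with t ht
      filter_upwards [ht] with x hx
      show q t x - p t x - c t = 0
      rw [hx, sub_self])
    filter_upwards [hD0] with z hz
    linarith
  · filter_upwards [hc, hsl] with t ht hts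
    refine ⟨?_, hts.1, hts.2.1⟩
    filter_upwards [ht] with x hx
    linarith

end PressureGauge

end Summit.NavierStokesRegularity.NavierStokesRegularity.Theorems

end
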